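import Literature.Topology.FourManifolds.TrisectionsFaceAmbient
import Literature.Topology.FourManifolds.TrisectionsFaceNormalForm
import Literature.Topology.FourManifolds.TrisectionsImplantPrelim
import Literature.Topology.FourManifolds.MorseBirthLemma
import HarnessLib

/-!
# Faces through the implant: reading and transporting Morse data of restrictions

Topic `Literature/Topology/FourManifolds`; infrastructure for the fact seat
`provefact-Literature.Topology.FourManifolds.exists-14560f9fc8` (named fact (c′)
`Literature.Topology.FourManifolds.exists_stabilized_gkTrisection`, Gay–Kirby 2016, Def. 8 and
Lemma 10).  Everything in this file is **proved**; no definitions, no named facts.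

Generic lemmas for following a face `Q` (in normal form, `FaceNormalForm`) through the
stabilisation implant, where it becomes `Q'` (equal to `Q` off the compact carrier `KX`):

* `exists_boundarySliceChart_of_inter_eq'` — a boundary slice chart of `S` restricted to an
  open set on which `S` and `S'` agree is one of `S'` (same local diffeomorphism);
* `morseData_transport_sets` — at a common interior point, for functions agreeing nearby, the
  Morse data of `f|S` and `f'|S'` coincide (read in the charts induced by the same local
  diffeomorphism, `MorseChartChangeInterior.lean`);
* `morseData_face_of_written` — if `u ↦ f (Θ⁻¹(u, 0))` agrees near the image point with a
  model function `g` on `ℝ³`, the Morse data of `f|S` at the (interior) point are those of `g`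
  (used on the carrier of the implant, where the faces are graphs of the birth function).

## References

* D. Gay, R. Kirby, *Trisecting 4-manifolds*, Geom. Topol. 20 (2016), Def. 8, Lemma 10.
  [GayKirby2016]
* J. Milnor, *Morse theory* (1963), §2. [Milnor1963]
* J. M. Lee, *Introduction to Smooth Manifolds* (2013), Thm. 5.51. [LeeSmoothManifolds2013]
-/

open scoped Manifold ContDiff Topology
open Set Function Filter

noncomputable section

namespace Literature.Topology.FourManifolds

universe u

section Transport

variable {X : Type u} [TopologicalSpace X] [ChartedSpace (EuclideanSpace ℝ (Fin 4)) X]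

/-- **A boundary slice chart of `S`, restricted to an open set on which `S` and `S'` agree, is a
boundary slice chart of `S'`** (same local diffeomorphism, restricted). [folklore] -/
theorem exists_boundarySliceChart_of_inter_eq' {S S' : Set X} (D : BoundarySliceChart 2 S)
    {V : Set X} (hV : IsOpen V) (h : ∀ q ∈ V, q ∈ S ↔ q ∈ S') :
    ∃ D' : BoundarySliceChart 2 S', D'.Θ.source = D.Θ.source ∩ V ∧ D'.Θ.target ⊆ D.Θ.target ∧
      (∀ q, D'.Θ q = D.Θ q) ∧ ∀ z, D'.Θ.symm z = D.Θ.symm z := by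
  refine ⟨{ Θ := D.Θ.restrOpen V hV
            contMDiffOn_toFun := D.contMDiffOn_toFun.mono (by
              rw [OpenPartialHomeomorph.restrOpen_source]; exact inter_subset_left)
            contMDiffOn_symm := D.contMDiffOn_symm.mono (by
              rw [OpenPartialHomeomorph.restrOpen_toPartialEquiv, PartialEquiv.restr_target]
              exact inter_subset_left)
            mem_iff := fun q hq => by
              rw [OpenPartialHomeomorph.restrOpen_source] at hq
              rw [← h q hq.2]
              exact D.mem_iff q hq.1 }, ?_, ?_, fun q => rfl, fun z => rfl⟩
  · show (D.Θ.restrOpen V hV).source = D.Θ.source ∩ V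
    rw [OpenPartialHomeomorph.restrOpen_source]
  · show (D.Θ.restrOpen V hV).target ⊆ D.Θ.target
    rw [OpenPartialHomeomorph.restrOpen_toPartialEquiv, PartialEquiv.restr_target]
    exact inter_subset_left

/-- **Morse data of restrictions to two subsets agreeing near a point, read through the same
local diffeomorphism.**  Let `D, D'` be boundary slice charts of `S, S'` with the same
underlying local diffeomorphism (`D'.Θ = D.Θ` on `D'.Θ.source`, `D'.Θ.symm = D.Θ.symm`,
`D'.Θ.target ⊆ D.Θ.target`), `p ∈ S ∩ S'` in both sources with `0 < (D.Θ p)₀` (an interior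
point), and `f' = f` near `p`.  Then, in the structures of any boundary slice atlases of `S`
and `S'`, `p` is critical for `f|S` iff it is for `f'|S'`, and then nondegeneracy and the Morse
index agree. [cite: Milnor1963, §2; LeeSmoothManifolds2013, Thm. 5.51] -/
theorem morseData_transport_sets [IsManifold (𝓡 4) ∞ X] {S S' : Set X}
    (Φ : BoundarySliceAtlas 2 S) (Φ' : BoundarySliceAtlas 2 S')
    (D : BoundarySliceChart 2 S) (D' : BoundarySliceChart 2 S')
    (hcoe : ∀ q, D'.Θ q = D.Θ q) (hsymm : ∀ z, D'.Θ.symm z = D.Θ.symm z)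
    {p : X} (hpS : p ∈ S) (hpS' : p ∈ S') (hpD : p ∈ D.Θ.source) (hpD' : p ∈ D'.Θ.source)
    (h0 : 0 < D.Θ p 0)
    {f f' : X → ℝ} (hf : ContMDiff (𝓡 4) 𝓘(ℝ, ℝ) ∞ f) (hf' : ContMDiff (𝓡 4) 𝓘(ℝ, ℝ) ∞ f')
    (heq : f' =ᶠ[𝓝 p] f) :
    ((letI := Φ.chartedSpace; IsMCriticalPt (𝓡∂ 3) (f ∘ Subtype.val : ↥S → ℝ) ⟨p, hpS⟩) ↔
      (letI := Φ'.chartedSpace; IsMCriticalPt (𝓡∂ 3) (f' ∘ Subtype.val : ↥S' → ℝ) ⟨p, hpS'⟩)) ∧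
    ((letI := Φ.chartedSpace; IsMCriticalPt (𝓡∂ 3) (f ∘ Subtype.val : ↥S → ℝ) ⟨p, hpS⟩) →
      ((letI := Φ.chartedSpace; (mhessian (𝓡∂ 3) (f ∘ Subtype.val : ↥S → ℝ) ⟨p, hpS⟩).Nondegenerate) ↔
        (letI := Φ'.chartedSpace; (mhessian (𝓡∂ 3) (f' ∘ Subtype.val : ↥S' → ℝ) ⟨p, hpS'⟩).Nondegenerate)) ∧
      (letI := Φ.chartedSpace; morseIndex (𝓡∂ 3) (f ∘ Subtype.val : ↥S → ℝ) ⟨p, hpS⟩) =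
        (letI := Φ'.chartedSpace; morseIndex (𝓡∂ 3) (f' ∘ Subtype.val : ↥S' → ℝ) ⟨p, hpS'⟩)) := by
  letI := Φ.chartedSpace
  letI := Φ'.chartedSpace
  haveI := Φ.isManifold
  haveI := Φ'.isManifold
  set pS : ↥S := ⟨p, hpS⟩ with hpSdef
  set pS' : ↥S' := ⟨p, hpS'⟩ with hpS'def
  -- the two charts with the same coordinates
  set Dc := D.chart pS with hDc
  set Dc' := D'.chart pS' with hDc'
  have hDcmem : Dc ∈ IsManifold.maximalAtlas (𝓡∂ 3) ∞ ↥S := Φ.chart_mem_maximalAtlas D pS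
  have hDc'mem : Dc' ∈ IsManifold.maximalAtlas (𝓡∂ 3) ∞ ↥S' := Φ'.chart_mem_maximalAtlas D' pS'
  have hpDc : pS ∈ Dc.source := by rw [hDc, D.chart_source]; exact hpD
  have hpDc' : pS' ∈ Dc'.source := by rw [hDc', D'.chart_source]; exact hpD'
  set u₀ : EuclideanSpace ℝ (Fin 3) := dropLast 2 (D.Θ p) with hu₀
  have hDcp : Dc.extend (𝓡∂ 3) pS = u₀ := D.extend_chart_apply hpDc
  have hDc'p : Dc'.extend (𝓡∂ 3) pS' = u₀ := by rw [hDc', D'.extend_chart_apply hpDc']; show dropLast 2 (D'.Θ p) = u₀; rw [hcoe]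
  have hmem2 : ∀ {T : Type u} [TopologicalSpace T] [ChartedSpace (EuclideanHalfSpace 3) T] {e : OpenPartialHomeomorph T (EuclideanHalfSpace 3)},
      e ∈ IsManifold.maximalAtlas (𝓡∂ 3) ∞ T → e ∈ IsManifold.maximalAtlas (𝓡∂ 3) 2 T := fun he =>
    IsManifold.maximalAtlas_subset_of_le (I := 𝓡∂ 3) ENat.LEInfty.out he
  have hmem1 : ∀ {T : Type u} [TopologicalSpace T] [ChartedSpace (EuclideanHalfSpace 3) T] {e : OpenPartialHomeomorph T (EuclideanHalfSpace 3)},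
      e ∈ IsManifold.maximalAtlas (𝓡∂ 3) ∞ T → e ∈ IsManifold.maximalAtlas (𝓡∂ 3) 1 T := fun he =>
    IsManifold.maximalAtlas_subset_of_le (I := 𝓡∂ 3) (by norm_num) he
  -- interior points
  have hu₀0 : 0 < u₀ 0 := by rw [hu₀, dropLast_apply_zero]; exact h0
  have hu₀int : u₀ ∈ interior (range (𝓡∂ 3)) := by
    rw [interior_range_modelWithCornersEuclideanHalfSpace]; exact hu₀0
  have hint : (𝓡∂ 3).IsInteriorPoint pS := by
    rw [isInteriorPoint_iff_of_mem_maximalAtlas (I := 𝓡∂ 3) (by simp) hDcmem hpDc, hDcp]; exact hu₀int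
  have hint' : (𝓡∂ 3).IsInteriorPoint pS' := by
    rw [isInteriorPoint_iff_of_mem_maximalAtlas (I := 𝓡∂ 3) (by simp) hDc'mem hpDc', hDc'p]; exact hu₀int
  -- ### the common written function
  set σ : EuclideanSpace ℝ (Fin 3) → EuclideanSpace ℝ (Fin 4) := fun u => snocEquiv 3 (u, 0) with hσ
  have hσc : Continuous σ := by
    have : Continuous fun u : EuclideanSpace ℝ (Fin 3) => (u, (0:ℝ)) := continuous_id.prodMk continuous_const
    exact (snocEquiv 3).continuous.comp this
  have hσu₀ : σ u₀ = D.Θ p := D.snocEquiv_dropLast_apply hpD hpS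
  set g : EuclideanSpace ℝ (Fin 3) → ℝ := fun u => f (D.Θ.symm (σ u)) with hg
  have hfval : ContMDiff (𝓡∂ 3) 𝓘(ℝ, ℝ) ∞ (f ∘ Subtype.val : ↥S → ℝ) := hf.comp Φ.contMDiff_subtype_val
  have hf'val : ContMDiff (𝓡∂ 3) 𝓘(ℝ, ℝ) ∞ (f' ∘ Subtype.val : ↥S' → ℝ) := hf'.comp Φ'.contMDiff_subtype_val
  have hev0 : ∀ᶠ u in 𝓝 u₀, 0 ≤ u 0 := by
    have hopen : IsOpen {u : EuclideanSpace ℝ (Fin 3) | 0 < u 0} :=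
      isOpen_lt continuous_const (EuclideanSpace.proj (0 : Fin 3)).continuous
    exact Filter.Eventually.mono (hopen.mem_nhds (show u₀ ∈ {u : EuclideanSpace ℝ (Fin 3) | 0 < u 0} from hu₀0))
      fun u hu => le_of_lt hu
  have hevT : ∀ᶠ u in 𝓝 u₀, σ u ∈ D.Θ.target :=
    hσc.continuousAt.preimage_mem_nhds (by rw [hσu₀]; exact D.Θ.open_target.mem_nhds (D.Θ.map_source hpD))
  have hevT' : ∀ᶠ u in 𝓝 u₀, σ u ∈ D'.Θ.target :=
    hσc.continuousAt.preimage_mem_nhds (by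
      rw [hσu₀, ← hcoe p]; exact D'.Θ.open_target.mem_nhds (D'.Θ.map_source hpD'))
  have hWS : ((f ∘ Subtype.val : ↥S → ℝ) ∘ (Dc.extend (𝓡∂ 3)).symm) =ᶠ[𝓝 u₀] g := by
    filter_upwards [hev0, hevT] with u hu0 huT
    show f (((Dc.extend (𝓡∂ 3)).symm u).1) = f (D.Θ.symm (σ u))
    rw [hDc, D.coe_extend_chart_symm_of_mem hu0 huT]
  have hWS' : ((f' ∘ Subtype.val : ↥S' → ℝ) ∘ (Dc'.extend (𝓡∂ 3)).symm) =ᶠ[𝓝 u₀] g := by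
    have hfeq : ∀ᶠ u in 𝓝 u₀, f' (D.Θ.symm (σ u)) = f (D.Θ.symm (σ u)) := by
      have hc : ContinuousAt (fun u => D.Θ.symm (σ u)) u₀ :=
        (D.Θ.continuousAt_symm (by rw [hσu₀]; exact D.Θ.map_source hpD)).comp hσc.continuousAt
      have h1 : D.Θ.symm (σ u₀) = p := by rw [hσu₀, D.Θ.left_inv hpD]
      have h2 : ∀ᶠ y in 𝓝 (D.Θ.symm (σ u₀)), f' y = f y := by rw [h1]; exact heq
      exact hc.eventually (p := fun y => f' y = f y) h2
    filter_upwards [hev0, hevT', hfeq] with u hu0 huT' hfu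
    show f' (((Dc'.extend (𝓡∂ 3)).symm u).1) = f (D.Θ.symm (σ u))
    rw [hDc', D'.coe_extend_chart_symm_of_mem hu0 huT', hsymm, hfu]
  -- ### criticality
  have hcS : IsMCriticalPt (𝓡∂ 3) (f ∘ Subtype.val : ↥S → ℝ) pS ↔ fderiv ℝ g u₀ = 0 := by
    rw [isMCriticalPt_iff_fderiv_comp_extend_symm_eq_zero_of_isInteriorPoint
      ((hfval.contMDiffAt (x := pS)).of_le ENat.LEInfty.out) (hmem2 hDcmem) hpDc hint, hDcp, hWS.fderiv_eq]
  have hcS' : IsMCriticalPt (𝓡∂ 3) (f' ∘ Subtype.val : ↥S' → ℝ) pS' ↔ fderiv ℝ g u₀ = 0 := by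
    rw [isMCriticalPt_iff_fderiv_comp_extend_symm_eq_zero_of_isInteriorPoint
      ((hf'val.contMDiffAt (x := pS')).of_le ENat.LEInfty.out) (hmem2 hDc'mem) hpDc' hint', hDc'p, hWS'.fderiv_eq]
  have hiff : IsMCriticalPt (𝓡∂ 3) (f ∘ Subtype.val : ↥S → ℝ) pS ↔
      IsMCriticalPt (𝓡∂ 3) (f' ∘ Subtype.val : ↥S' → ℝ) pS' := hcS.trans hcS'.symm
  refine ⟨hiff, fun hcrit => ?_⟩
  have hcrit' := hiff.1 hcrit
  -- ### the chart Hessians coincide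
  have hHess : hessianInChart (𝓡∂ 3) Dc (f ∘ Subtype.val : ↥S → ℝ) pS =
      hessianInChart (𝓡∂ 3) Dc' (f' ∘ Subtype.val : ↥S' → ℝ) pS' := by
    ext v v'
    rw [hessianInChart_apply_eq_fderiv_fderiv_of_isInteriorPoint (I := 𝓡∂ 3) (hmem1 hDcmem) hpDc hint,
      hessianInChart_apply_eq_fderiv_fderiv_of_isInteriorPoint (I := 𝓡∂ 3) (hmem1 hDc'mem) hpDc' hint',
      hDcp, hDc'p, hWS.fderiv.fderiv_eq, hWS'.fderiv.fderiv_eq]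
  have hf2 : ContMDiffAt (𝓡∂ 3) 𝓘(ℝ, ℝ) 2 (f ∘ Subtype.val : ↥S → ℝ) pS := (hfval.contMDiffAt (x := pS)).of_le ENat.LEInfty.out
  have hf'2 : ContMDiffAt (𝓡∂ 3) 𝓘(ℝ, ℝ) 2 (f' ∘ Subtype.val : ↥S' → ℝ) pS' := (hf'val.contMDiffAt (x := pS')).of_le ENat.LEInfty.out
  refine ⟨?_, ?_⟩
  · rw [nondegenerate_mhessian_iff_of_isInteriorPoint hf2 hcrit (hmem2 hDcmem) hpDc hint,
      nondegenerate_mhessian_iff_of_isInteriorPoint hf'2 hcrit' (hmem2 hDc'mem) hpDc' hint', hHess]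
  · rw [morseIndex_eq_sigNeg_hessianInChart_of_isInteriorPoint hf2 hcrit (hmem2 hDcmem) hpDc hint,
      morseIndex_eq_sigNeg_hessianInChart_of_isInteriorPoint hf'2 hcrit' (hmem2 hDc'mem) hpDc' hint', hHess]

/-- **Morse data of a restriction read through a boundary slice chart with an explicit model
function.**  If, in the boundary slice chart `D` of `S` at the interior point `p`, the function
`u ↦ f (Θ⁻¹ (u, 0))` agrees near the image point `u₀` with a function `g` on `ℝ³`, then (in the
structure of any boundary slice atlas of `S`) `p` is critical for `f|S` iff `u₀` is critical
for `g`, and then nondegeneracy and the index are those of `g` at `u₀`.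
[cite: Milnor1963, §2; LeeSmoothManifolds2013, Thm. 5.51] -/
theorem morseData_face_of_written [IsManifold (𝓡 4) ∞ X] {S : Set X}
    (Φ : BoundarySliceAtlas 2 S) (D : BoundarySliceChart 2 S)
    {p : X} (hpS : p ∈ S) (hpD : p ∈ D.Θ.source) (h0 : 0 < D.Θ p 0)
    {f : X → ℝ} (hf : ContMDiff (𝓡 4) 𝓘(ℝ, ℝ) ∞ f) {g : EuclideanSpace ℝ (Fin 3) → ℝ}
    (heq : (fun u => f (D.Θ.symm (snocEquiv 3 (u, 0)))) =ᶠ[𝓝 (dropLast 2 (D.Θ p))] g) :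
    letI := Φ.chartedSpace
    (IsMCriticalPt (𝓡∂ 3) (f ∘ Subtype.val : ↥S → ℝ) ⟨p, hpS⟩ ↔
      IsMCriticalPt (𝓡 3) g (dropLast 2 (D.Θ p))) ∧
    (IsMCriticalPt (𝓡∂ 3) (f ∘ Subtype.val : ↥S → ℝ) ⟨p, hpS⟩ →
      ((mhessian (𝓡∂ 3) (f ∘ Subtype.val : ↥S → ℝ) ⟨p, hpS⟩).Nondegenerate ↔
        (mhessian (𝓡 3) g (dropLast 2 (D.Θ p))).Nondegenerate) ∧
      morseIndex (𝓡∂ 3) (f ∘ Subtype.val : ↥S → ℝ) ⟨p, hpS⟩ =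
        morseIndex (𝓡 3) g (dropLast 2 (D.Θ p))) := by
  letI := Φ.chartedSpace
  haveI := Φ.isManifold
  set pS : ↥S := ⟨p, hpS⟩ with hpSdef
  set Dc := D.chart pS with hDc
  have hDcmem : Dc ∈ IsManifold.maximalAtlas (𝓡∂ 3) ∞ ↥S := Φ.chart_mem_maximalAtlas D pS
  have hDcmem2 : Dc ∈ IsManifold.maximalAtlas (𝓡∂ 3) 2 ↥S :=
    IsManifold.maximalAtlas_subset_of_le (M := ↥S) (I := 𝓡∂ 3) ENat.LEInfty.out hDcmem
  have hDcmem1 : Dc ∈ IsManifold.maximalAtlas (𝓡∂ 3) 1 ↥S :=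
    IsManifold.maximalAtlas_subset_of_le (M := ↥S) (I := 𝓡∂ 3) (by norm_num) hDcmem
  have hpDc : pS ∈ Dc.source := by rw [hDc, D.chart_source]; exact hpD
  set u₀ : EuclideanSpace ℝ (Fin 3) := dropLast 2 (D.Θ p) with hu₀
  have hDcp : Dc.extend (𝓡∂ 3) pS = u₀ := D.extend_chart_apply hpDc
  have hu₀0 : 0 < u₀ 0 := by rw [hu₀, dropLast_apply_zero]; exact h0
  have hu₀int : u₀ ∈ interior (range (𝓡∂ 3)) := by
    rw [interior_range_modelWithCornersEuclideanHalfSpace]; exact hu₀0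
  have hint : (𝓡∂ 3).IsInteriorPoint pS := by
    rw [isInteriorPoint_iff_of_mem_maximalAtlas (I := 𝓡∂ 3) (by simp) hDcmem hpDc, hDcp]; exact hu₀int
  -- the written function agrees with `g`
  set σ : EuclideanSpace ℝ (Fin 3) → EuclideanSpace ℝ (Fin 4) := fun u => snocEquiv 3 (u, 0) with hσ
  have hσc : Continuous σ := by
    have : Continuous fun u : EuclideanSpace ℝ (Fin 3) => (u, (0:ℝ)) := continuous_id.prodMk continuous_const
    exact (snocEquiv 3).continuous.comp this
  have hσu₀ : σ u₀ = D.Θ p := D.snocEquiv_dropLast_apply hpD hpS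
  have hfval : ContMDiff (𝓡∂ 3) 𝓘(ℝ, ℝ) ∞ (f ∘ Subtype.val : ↥S → ℝ) := hf.comp Φ.contMDiff_subtype_val
  have hev0 : ∀ᶠ u in 𝓝 u₀, 0 ≤ u 0 := by
    have hopen : IsOpen {u : EuclideanSpace ℝ (Fin 3) | 0 < u 0} :=
      isOpen_lt continuous_const (EuclideanSpace.proj (0 : Fin 3)).continuous
    exact Filter.Eventually.mono (hopen.mem_nhds (show u₀ ∈ {u : EuclideanSpace ℝ (Fin 3) | 0 < u 0} from hu₀0))
      fun u hu => le_of_lt hu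
  have hevT : ∀ᶠ u in 𝓝 u₀, σ u ∈ D.Θ.target :=
    hσc.continuousAt.preimage_mem_nhds (by rw [hσu₀]; exact D.Θ.open_target.mem_nhds (D.Θ.map_source hpD))
  have hW : ((f ∘ Subtype.val : ↥S → ℝ) ∘ (Dc.extend (𝓡∂ 3)).symm) =ᶠ[𝓝 u₀] g := by
    have h1 : ((f ∘ Subtype.val : ↥S → ℝ) ∘ (Dc.extend (𝓡∂ 3)).symm) =ᶠ[𝓝 u₀] fun u => f (D.Θ.symm (σ u)) := by
      filter_upwards [hev0, hevT] with u hu0 huT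
      show f (((Dc.extend (𝓡∂ 3)).symm u).1) = f (D.Θ.symm (σ u))
      rw [hDc, D.coe_extend_chart_symm_of_mem hu0 huT]
    exact h1.trans heq
  -- criticality
  have hcS : IsMCriticalPt (𝓡∂ 3) (f ∘ Subtype.val : ↥S → ℝ) pS ↔ fderiv ℝ g u₀ = 0 := by
    rw [isMCriticalPt_iff_fderiv_comp_extend_symm_eq_zero_of_isInteriorPoint
      ((hfval.contMDiffAt (x := pS)).of_le ENat.LEInfty.out) hDcmem2 hpDc hint, hDcp, hW.fderiv_eq]
  have hiff : IsMCriticalPt (𝓡∂ 3) (f ∘ Subtype.val : ↥S → ℝ) pS ↔ IsMCriticalPt (𝓡 3) g u₀ := by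
    rw [hcS, MorseBirth.isMCriticalPt_iff_fderiv (n := 2)]
  refine ⟨hiff, fun hcrit => ?_⟩
  have hHess : ∀ v w, hessianInChart (𝓡∂ 3) Dc (f ∘ Subtype.val : ↥S → ℝ) pS v w = mhessian (𝓡 3) g u₀ v w := by
    intro v w
    rw [hessianInChart_apply_eq_fderiv_fderiv_of_isInteriorPoint (I := 𝓡∂ 3) hDcmem1 hpDc hint, hDcp,
      hW.fderiv.fderiv_eq, MorseBirth.mhessian_model_apply (n := 2)]
  have hHeq : hessianInChart (𝓡∂ 3) Dc (f ∘ Subtype.val : ↥S → ℝ) pS = mhessian (𝓡 3) g u₀ := by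
    ext v w; exact hHess v w
  have hf2 : ContMDiffAt (𝓡∂ 3) 𝓘(ℝ, ℝ) 2 (f ∘ Subtype.val : ↥S → ℝ) pS :=
    (hfval.contMDiffAt (x := pS)).of_le ENat.LEInfty.out
  refine ⟨?_, ?_⟩
  · rw [nondegenerate_mhessian_iff_of_isInteriorPoint hf2 hcrit hDcmem2 hpDc hint, hHeq]
  · rw [morseIndex_eq_sigNeg_hessianInChart_of_isInteriorPoint hf2 hcrit hDcmem2 hpDc hint, hHeq]
    rfl

end Transport

end Literature.Topology.FourManifolds
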